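import Summits.MatrixMultiplication.MatrixMultiplication.Theses.FarEdgeDescent
import Literature.Computability.AlgebraicComplexity.RectangularExponentInformationBound
import HarnessLib

/-!
# Route `FarEdgeDescent` — split glue `FiniteSaturationGlue` (stmt-MatrixMultiplication-25349), PROVED

`PowerAmortisation → OctaveFlatness → FiniteSaturation`: if the rectangular excess
`e(k) := ω(1,k,1) − (k+1)` decays like a power `C·k^{−δ}` AND is octave-flat (`e(k) ≤ l·e(2k)` eventually, for
every `l > 1`), then `e` vanishes at some integer `k ≥ 2`.  Proof: pick `l := 2^{δ/2}`; iterating the octave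
inequality from `m := k₀+1` gives `e(m) ≤ l^j e(2^j m) ≤ C m^{−δ} (2^{−δ/2})^j → 0`, and `e(m) ≥ 0`
(information lower bound `ω(1,k,1) ≥ k+1`).  (The converse — both children are NECESSARY,
`FiniteSaturation ↔ PowerAmortisation ∧ OctaveFlatness` — is kernel-checked in the lens probe
`HOME/decomp-mm-lens-2/TreeProbe_v2.lean`, not repeated here to keep this landing file to the one item.)

PROVER-READY DRAFT written by the decomp-mm lens-2 planner seat (gen 5): imports only BUILT modules (the route
file + Literature).  `lean check`: rc 0 · 0 sorry.  A prover may propose this file as is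
(`--workitem stmt-MatrixMultiplication-25349`).
-/

set_option linter.dupNamespace false

noncomputable section

namespace Summit.MatrixMultiplication.MatrixMultiplication.Theorems.FarEdgeDescentGlue

open Literature.Computability.AlgebraicComplexity
open Summit.MatrixMultiplication.MatrixMultiplication.Theses.FarEdgeDescent

/-! ## The excess `e(x) = ω(1,x,1) − (x+1)` is nonnegative -/

/-- `e(x) ≥ 0`: the information lower bound `ω(1,x,1) ≥ max(2, x + 1)`. -/
theorem excess_nonneg (x : ℝ) : 0 ≤ omegaRect ℂ 1 x 1 - (x + 1) := by
  have h := le_trans (le_max_right _ _) (max_two_add_one_le_omegaRect_one_mid_one ℂ x)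
  linarith

/-! ## The glue -/

/-- **The split glue item, by name** (stmt-MatrixMultiplication-25349):
`PowerAmortisation → OctaveFlatness → FiniteSaturation`. -/
theorem finiteSaturationGlue :
    Summit.MatrixMultiplication.MatrixMultiplication.Theses.FarEdgeDescent.FiniteSaturationGlue := by
  intro hP hF
  obtain ⟨δ, C, hδ, hPA⟩ := hP
  by_cases hC : C ≤ 0
  · -- e(2) ≤ C·2^{−δ} ≤ 0
    refine ⟨2, le_rfl, ?_⟩
    have h := hPA 2 (by norm_num)
    have hpos : (0 : ℝ) < ((2 : ℕ) : ℝ) ^ (-δ) := Real.rpow_pos_of_pos (by norm_num) _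
    have hle : C * ((2 : ℕ) : ℝ) ^ (-δ) ≤ 0 := mul_nonpos_iff.2 (Or.inr ⟨hC, hpos.le⟩)
    have h0 := excess_nonneg ((2 : ℕ) : ℝ)
    push_cast at h h0 hle ⊢
    linarith
  · push Not at hC
    set l : ℝ := (2 : ℝ) ^ (δ / 2) with hl_def
    have hl : 1 < l := Real.one_lt_rpow (by norm_num) (by linarith)
    obtain ⟨k₀, hk₀, hOF⟩ := hF l hl
    set m : ℕ := k₀ + 1 with hm_def
    have hm2 : 2 ≤ m := by omega
    have hmk : k₀ ≤ m := by omega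
    have hm0 : (0 : ℝ) < m := by exact_mod_cast (show 0 < m by omega)
    -- iterate the octave inequality
    have iter : ∀ j : ℕ, omegaRect ℂ 1 (m : ℝ) 1 - ((m : ℝ) + 1) ≤
        l ^ j * (omegaRect ℂ 1 ((2 : ℝ) ^ j * (m : ℝ)) 1 - ((2 : ℝ) ^ j * (m : ℝ) + 1)) := by
      intro j
      induction j with
      | zero => simp
      | succ j ih =>
        have hk : k₀ ≤ 2 ^ j * m := le_trans hmk (Nat.le_mul_of_pos_left m (by positivity))
        have step := hOF (2 ^ j * m) hk
        push_cast at step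
        have e2 : (2 : ℝ) * (2 ^ j * (m : ℝ)) = 2 ^ (j + 1) * (m : ℝ) := by ring
        rw [e2] at step
        have hlj : 0 ≤ l ^ j := pow_nonneg (by linarith) j
        calc omegaRect ℂ 1 (m : ℝ) 1 - ((m : ℝ) + 1)
            ≤ l ^ j * (omegaRect ℂ 1 ((2 : ℝ) ^ j * (m : ℝ)) 1 - ((2 : ℝ) ^ j * (m : ℝ) + 1)) := ih
          _ ≤ l ^ j * (l * (omegaRect ℂ 1 ((2 : ℝ) ^ (j + 1) * (m : ℝ)) 1
                - ((2 : ℝ) ^ (j + 1) * (m : ℝ) + 1))) := mul_le_mul_of_nonneg_left step hlj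
          _ = l ^ (j + 1) * (omegaRect ℂ 1 ((2 : ℝ) ^ (j + 1) * (m : ℝ)) 1
                - ((2 : ℝ) ^ (j + 1) * (m : ℝ) + 1)) := by rw [pow_succ]; ring
    -- combine with the power bound at 2^j m
    set r : ℝ := (2 : ℝ) ^ (-(δ / 2)) with hr_def
    have hr0 : 0 ≤ r := Real.rpow_nonneg (by norm_num) _
    have hr1 : r < 1 := Real.rpow_lt_one_of_one_lt_of_neg (by norm_num) (by linarith)
    have bound : ∀ j : ℕ, omegaRect ℂ 1 (m : ℝ) 1 - ((m : ℝ) + 1) ≤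
        C * (m : ℝ) ^ (-δ) * r ^ j := by
      intro j
      have hk1 : 1 ≤ 2 ^ j * m := le_trans (by omega) (Nat.le_mul_of_pos_left m (by positivity))
      have hpa := hPA (2 ^ j * m) hk1
      push_cast at hpa
      have hlj : 0 ≤ l ^ j := pow_nonneg (by linarith) j
      have h1 : l ^ j = (2 : ℝ) ^ (δ / 2 * (j : ℝ)) := by
        rw [hl_def, ← Real.rpow_natCast, ← Real.rpow_mul (by norm_num)]
      have h2 : ((2 : ℝ) ^ j) ^ (-δ) = (2 : ℝ) ^ ((j : ℝ) * (-δ)) := by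
        rw [← Real.rpow_natCast, ← Real.rpow_mul (by norm_num)]
      have h3 : r ^ j = (2 : ℝ) ^ (-(δ / 2) * (j : ℝ)) := by
        rw [hr_def, ← Real.rpow_natCast, ← Real.rpow_mul (by norm_num)]
      have h4 : (2 : ℝ) ^ (δ / 2 * (j : ℝ)) * (2 : ℝ) ^ ((j : ℝ) * (-δ)) =
          (2 : ℝ) ^ (-(δ / 2) * (j : ℝ)) := by
        rw [← Real.rpow_add (by norm_num : (0 : ℝ) < 2)]
        congr 1
        ring
      have key : l ^ j * (C * ((2 : ℝ) ^ j * (m : ℝ)) ^ (-δ)) = C * (m : ℝ) ^ (-δ) * r ^ j := by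
        rw [Real.mul_rpow (by positivity) hm0.le, h1, h2, h3]
        calc (2 : ℝ) ^ (δ / 2 * (j : ℝ)) * (C * ((2 : ℝ) ^ ((j : ℝ) * (-δ)) * (m : ℝ) ^ (-δ)))
            = C * (m : ℝ) ^ (-δ) * ((2 : ℝ) ^ (δ / 2 * (j : ℝ)) * (2 : ℝ) ^ ((j : ℝ) * (-δ))) := by
              ring
          _ = C * (m : ℝ) ^ (-δ) * (2 : ℝ) ^ (-(δ / 2) * (j : ℝ)) := by rw [h4]
      calc omegaRect ℂ 1 (m : ℝ) 1 - ((m : ℝ) + 1)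
          ≤ l ^ j * (omegaRect ℂ 1 ((2 : ℝ) ^ j * (m : ℝ)) 1 - ((2 : ℝ) ^ j * (m : ℝ) + 1)) := iter j
        _ ≤ l ^ j * (C * ((2 : ℝ) ^ j * (m : ℝ)) ^ (-δ)) := mul_le_mul_of_nonneg_left hpa hlj
        _ = C * (m : ℝ) ^ (-δ) * r ^ j := key
    have hlim : Filter.Tendsto (fun j : ℕ => C * (m : ℝ) ^ (-δ) * r ^ j) Filter.atTop (nhds 0) := by
      have := (tendsto_pow_atTop_nhds_zero_of_lt_one hr0 hr1).const_mul (C * (m : ℝ) ^ (-δ))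
      simpa using this
    have hle : omegaRect ℂ 1 (m : ℝ) 1 - ((m : ℝ) + 1) ≤ 0 :=
      le_of_tendsto_of_tendsto' tendsto_const_nhds hlim bound
    have hge := excess_nonneg (m : ℝ)
    exact ⟨m, hm2, by linarith⟩

end Summit.MatrixMultiplication.MatrixMultiplication.Theorems.FarEdgeDescentGlue

end
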